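import Mathlib
import Summits.ABC.ABC.Statement

/-!
# The door at the level of polynomial abc: Philippon's minimal sharpening of Liouville
(solo-ABC-informed, session 10)

P. Philippon, *Addendum à quelques remarques sur des questions d'approximation diophantienne*,
Bull. Austral. Math. Soc. **61** (2000) 167–169 [cite: Philippon2000Addendum, Conjecture and Conséquence,
p. 167–168], isolates "l'amélioration la plus minime de l'inégalité de Liouville qu'il
conviendrait d'établir" in the direction of abc:

> **Conjecture (Philippon 2000).** There are reals `0 < ε < 1/2`, `α > 1`, `β > 0` and an integer
> `B ≥ 1` such that for all `x, y ∈ ℚ^×` with `x y^B ≠ −1`,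
> `∑_{p ∈ S} −log |x y^B + 1|_p ≤ B · (α h(x) + ε h(y)) + (α B + ε) · (∑_{p ∈ S} log p + β)`,
> `S` being the set of primes with `|x y^B + 1|_p < 1`.

With `|p|_p = 1/p` and `h` the logarithmic height on `ℚ`, the left side is `log |num (x y^B + 1)|`
and `∑_{p ∈ S} log p = log rad (num (x y^B + 1))`, which is how the hypothesis is written below
(inline; no `Prop` constant is introduced).  For `ε = 1` the inequality is a trivial consequence
of Liouville's inequality `h(x y^B + 1) ≤ h(x) + B h(y) + log 2` (op. cit., Remarque (1));
`soloInformed_philippon_of_liouville` records this in the kernel, so the content of the conjecture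
is exactly the factor `ε < 1/2` in front of `B h(y)`, bought at the price `α` on `h(x)` and the
radical term.  Philippon's *Conséquence* is polynomial abc:
`log c ≤ (B(αB+ε)/(1−2ε)) (log rad(abc) + β)`.

This file proves the implication (`soloInformed_log_le_of_philippon`, with the slightly weaker
constant `(2αB² + αB + ε)/(1−2ε)`, and `soloInformed_polynomialABC_of_philippon` in the shape of
`SoloInformedWall.lean`), by Philippon's argument: split `a/b = x · y^B` with `y = u_a/u_b`,
`u_n = ∏_{p ∣ n} p^{⌊v_p(n)/B⌋}` the `B`-th-power part, and `x = r_a/r_b`,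
`r_n = ∏_{p ∣ n} p^{v_p(n) mod B} ≤ rad(n)^B`; then `x y^B + 1 = c/b` has numerator `c`,
`h(x) ≤ 2B log rad(abc)`, `B h(y) ≤ 2 log c`, and the `ε h(y)` term is absorbed.

Role in the seat's report (`run/shared/lean/ideation/ABC/solo-informed/paper/paper.md`, §2 and §5):
this is the printed form of the "uniform ε-improvement of Liouville" door at the level of
polynomial abc (W); the seat's face (F5) is its one-prime, one-family shadow, and the `p`-adic
door `H(σ)` of `SoloInformedDoorB.lean` (products of heights) reaches only subexponential abc (W⁻).
No claim is made about the conjecture itself. [cite: Philippon2000Addendum, p. 167–168]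
[cite: Philippon1999, §3]

## References
* [Philippon2000Addendum] P. Philippon, Bull. Austral. Math. Soc. 61 (2000) 167–169,
  doi:10.1017/S0004972700022127 — Conjecture, Conséquence, Remarques (1)–(3).
* [Philippon1999] P. Philippon, *Quelques remarques sur des questions d'approximation
  diophantienne*, Bull. Austral. Math. Soc. 59 (1999) 323–334, doi:10.1017/S0004972700032937 — §3.
-/

noncomputable section

open Finset Real Height UniqueFactorizationMonoid
open Literature.NumberTheory.DiophantineGeometry

namespace Summit.ABC.ABC.Theorems

/-! ### The `B`-th-power part and the residual part of a natural number -/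

/-- `(∏_{p ∣ n} p^{⌊v_p(n)/B⌋})^B · ∏_{p ∣ n} p^{v_p(n) mod B} = n`. [folklore] -/
theorem soloInformed_powPart_pow_mul_resPart (B : ℕ) {n : ℕ} (hn : n ≠ 0) :
    (∏ p ∈ n.primeFactors, p ^ (n.factorization p / B)) ^ B *
        ∏ p ∈ n.primeFactors, p ^ (n.factorization p % B) = n := by
  rw [← Finset.prod_pow, ← Finset.prod_mul_distrib]
  conv_rhs => rw [Nat.prod_primeFactors_pow_factorization hn]
  refine Finset.prod_congr rfl fun p _ => ?_
  rw [← pow_mul, ← pow_add, Nat.div_add_mod']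

/-- The residual part is at most `rad(n)^B` (for `B ≥ 1`). [folklore] -/
theorem soloInformed_resPart_le {B n : ℕ} (hB : 0 < B) :
    ∏ p ∈ n.primeFactors, p ^ (n.factorization p % B) ≤ (radical n) ^ B := by
  rw [Nat.radical_eq_prod_primeFactors, ← Finset.prod_pow]
  refine Finset.prod_le_prod (fun _ _ => Nat.zero_le _) fun p hp => ?_
  exact Nat.pow_le_pow_right (Nat.pos_of_mem_primeFactors hp) (Nat.mod_lt _ hB).le

/-- The `B`-th-power part and the residual part are positive. [folklore] -/
theorem soloInformed_parts_pos (n : ℕ) (e : ℕ → ℕ) :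
    0 < ∏ p ∈ n.primeFactors, p ^ e p :=
  Finset.prod_pos fun _ hp => pow_pos (Nat.pos_of_mem_primeFactors hp) _

/-! ### Philippon's Conséquence: the conjecture implies polynomial abc -/

/-- **Philippon's splitting of an abc-triple.** For `B ≥ 1` write `a/b = x · y^B` with
`y = u_a/u_b` the quotient of the `B`-th-power parts and `x = r_a/r_b` the quotient of the residual
parts; then `x y^B + 1 = c/b` has numerator `c`, `h(x) ≤ 2B log rad(abc)` and `B h(y) ≤ 2 log c`.
[cite: Philippon2000Addendum, Démonstration, p. 167–168] -/
theorem soloInformed_philippon_split {a b c B : ℕ} (habc : IsABCTriple a b c) (hB : 0 < B) :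
    ∃ x y : ℚ, x ≠ 0 ∧ y ≠ 0 ∧ x * y ^ B + 1 ≠ 0 ∧ (x * y ^ B + 1).num.natAbs = c ∧
      logHeight₁ x ≤ 2 * B * Real.log ((rad a b c : ℕ) : ℝ) ∧
      (B : ℝ) * logHeight₁ y ≤ 2 * Real.log (c : ℝ) := by
  obtain ⟨ha, hb, hsum, hcop⟩ := habc
  have hc : 0 < c := by omega
  have hac : a ≤ c := by omega
  have hbc : b ≤ c := by omega
  -- the four parts
  obtain ⟨ua, hua_def⟩ : ∃ ua : ℕ, ua = ∏ p ∈ a.primeFactors, p ^ (a.factorization p / B) :=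
    ⟨_, rfl⟩
  obtain ⟨ra, hra_def⟩ : ∃ ra : ℕ, ra = ∏ p ∈ a.primeFactors, p ^ (a.factorization p % B) :=
    ⟨_, rfl⟩
  obtain ⟨ub, hub_def⟩ : ∃ ub : ℕ, ub = ∏ p ∈ b.primeFactors, p ^ (b.factorization p / B) :=
    ⟨_, rfl⟩
  obtain ⟨rb, hrb_def⟩ : ∃ rb : ℕ, rb = ∏ p ∈ b.primeFactors, p ^ (b.factorization p % B) :=
    ⟨_, rfl⟩
  have hA : ua ^ B * ra = a := by
    rw [hua_def, hra_def]; exact soloInformed_powPart_pow_mul_resPart B ha.ne'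
  have hBb : ub ^ B * rb = b := by
    rw [hub_def, hrb_def]; exact soloInformed_powPart_pow_mul_resPart B hb.ne'
  have hua0 : 0 < ua := by rw [hua_def]; exact soloInformed_parts_pos a _
  have hra0 : 0 < ra := by rw [hra_def]; exact soloInformed_parts_pos a _
  have hub0 : 0 < ub := by rw [hub_def]; exact soloInformed_parts_pos b _
  have hrb0 : 0 < rb := by rw [hrb_def]; exact soloInformed_parts_pos b _
  have hra_le : ra ≤ radical a ^ B := by rw [hra_def]; exact soloInformed_resPart_le hB
  have hrb_le : rb ≤ radical b ^ B := by rw [hrb_def]; exact soloInformed_resPart_le hB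
  have huaB_le : ua ^ B ≤ a := Nat.le_of_dvd ha ⟨ra, hA.symm⟩
  have hubB_le : ub ^ B ≤ b := Nat.le_of_dvd hb ⟨rb, hBb.symm⟩
  -- the radical bookkeeping
  have habc0 : a * b * c ≠ 0 := Nat.pos_iff_ne_zero.mp (Nat.mul_pos (Nat.mul_pos ha hb) hc)
  have hR0 : 0 < rad a b c := Nat.radical_pos _
  have hrada_le : radical a ≤ rad a b c :=
    Nat.le_of_dvd hR0 (radical_dvd_radical (Dvd.intro (b * c) (by ring)) habc0)
  have hradb_le : radical b ≤ rad a b c :=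
    Nat.le_of_dvd hR0 (radical_dvd_radical (Dvd.intro (a * c) (by ring)) habc0)
  -- the rationals x, y
  have hraQ : (ra : ℚ) ≠ 0 := by exact_mod_cast hra0.ne'
  have hrbQ : (rb : ℚ) ≠ 0 := by exact_mod_cast hrb0.ne'
  have huaQ : (ua : ℚ) ≠ 0 := by exact_mod_cast hua0.ne'
  have hubQ : (ub : ℚ) ≠ 0 := by exact_mod_cast hub0.ne'
  have hbQ : (b : ℚ) ≠ 0 := by exact_mod_cast hb.ne'
  have e1 : (ra : ℚ) * (ua : ℚ) ^ B = a := by rw [mul_comm]; exact_mod_cast hA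
  have e2 : (rb : ℚ) * (ub : ℚ) ^ B = b := by rw [mul_comm]; exact_mod_cast hBb
  have hxy : (ra : ℚ) / rb * ((ua : ℚ) / ub) ^ B + 1 = (c : ℚ) / b := by
    rw [div_pow, div_mul_div_comm, e1, e2, div_add_one hbQ]
    congr 1
    exact_mod_cast hsum
  have hcb : Nat.Coprime c b := by
    rw [← hsum]; exact Nat.coprime_add_self_left.mpr hcop
  have hnum : ((c : ℚ) / b).num = c := by
    have h := Rat.num_div_eq_of_coprime (a := (c : ℤ)) (b := (b : ℤ)) (by exact_mod_cast hb)
      (by simpa using hcb)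
    push_cast at h
    exact h
  refine ⟨(ra : ℚ) / rb, (ua : ℚ) / ub, div_ne_zero hraQ hrbQ, div_ne_zero huaQ hubQ,
    ?_, ?_, ?_, ?_⟩
  · rw [hxy]; exact div_ne_zero (by exact_mod_cast hc.ne') hbQ
  · rw [hxy, hnum]; simp
  · -- height of x
    have hlog_ra : logHeight₁ (ra : ℚ) = Real.log ra := by
      haveI : NeZero ra := ⟨hra0.ne'⟩; exact Rat.logHeight₁_natCast ra
    have hlog_rb : logHeight₁ (rb : ℚ) = Real.log rb := by
      haveI : NeZero rb := ⟨hrb0.ne'⟩; exact Rat.logHeight₁_natCast rb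
    have hhx : logHeight₁ ((ra : ℚ) / rb) ≤ Real.log ra + Real.log rb := by
      have h1 := logHeight₁_mul_le (ra : ℚ) ((rb : ℚ)⁻¹)
      rw [← div_eq_mul_inv, logHeight₁_inv, hlog_ra, hlog_rb] at h1
      exact h1
    have hra_pos : (0 : ℝ) < ra := by exact_mod_cast hra0
    have hrb_pos : (0 : ℝ) < rb := by exact_mod_cast hrb0
    have hrada_pos : (0 : ℝ) < (radical a : ℕ) := by exact_mod_cast Nat.radical_pos a
    have hradb_pos : (0 : ℝ) < (radical b : ℕ) := by exact_mod_cast Nat.radical_pos b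
    have h_ra : Real.log ra ≤ B * Real.log ((rad a b c : ℕ) : ℝ) := by
      calc Real.log ra ≤ Real.log (((radical a : ℕ) : ℝ) ^ B) :=
            Real.log_le_log hra_pos (by exact_mod_cast hra_le)
        _ = B * Real.log ((radical a : ℕ) : ℝ) := Real.log_pow _ _
        _ ≤ B * Real.log ((rad a b c : ℕ) : ℝ) :=
            mul_le_mul_of_nonneg_left
              (Real.log_le_log hrada_pos (by exact_mod_cast hrada_le)) (by positivity)
    have h_rb : Real.log rb ≤ B * Real.log ((rad a b c : ℕ) : ℝ) := by
      calc Real.log rb ≤ Real.log (((radical b : ℕ) : ℝ) ^ B) :=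
            Real.log_le_log hrb_pos (by exact_mod_cast hrb_le)
        _ = B * Real.log ((radical b : ℕ) : ℝ) := Real.log_pow _ _
        _ ≤ B * Real.log ((rad a b c : ℕ) : ℝ) :=
            mul_le_mul_of_nonneg_left
              (Real.log_le_log hradb_pos (by exact_mod_cast hradb_le)) (by positivity)
    linarith
  · -- height of y
    have hlog_ua : logHeight₁ (ua : ℚ) = Real.log ua := by
      haveI : NeZero ua := ⟨hua0.ne'⟩; exact Rat.logHeight₁_natCast ua
    have hlog_ub : logHeight₁ (ub : ℚ) = Real.log ub := by
      haveI : NeZero ub := ⟨hub0.ne'⟩; exact Rat.logHeight₁_natCast ub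
    have hhy : logHeight₁ ((ua : ℚ) / ub) ≤ Real.log ua + Real.log ub := by
      have h1 := logHeight₁_mul_le (ua : ℚ) ((ub : ℚ)⁻¹)
      rw [← div_eq_mul_inv, logHeight₁_inv, hlog_ua, hlog_ub] at h1
      exact h1
    have hua_pos : (0 : ℝ) < ua := by exact_mod_cast hua0
    have hub_pos : (0 : ℝ) < ub := by exact_mod_cast hub0
    have h_ua : (B : ℝ) * Real.log ua ≤ Real.log c := by
      calc (B : ℝ) * Real.log ua = Real.log ((ua : ℝ) ^ B) := (Real.log_pow _ _).symm
        _ ≤ Real.log a := Real.log_le_log (pow_pos hua_pos _) (by exact_mod_cast huaB_le)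
        _ ≤ Real.log c := Real.log_le_log (by exact_mod_cast ha) (by exact_mod_cast hac)
    have h_ub : (B : ℝ) * Real.log ub ≤ Real.log c := by
      calc (B : ℝ) * Real.log ub = Real.log ((ub : ℝ) ^ B) := (Real.log_pow _ _).symm
        _ ≤ Real.log b := Real.log_le_log (pow_pos hub_pos _) (by exact_mod_cast hubB_le)
        _ ≤ Real.log c := Real.log_le_log (by exact_mod_cast hb) (by exact_mod_cast hbc)
    have hB0 : (0 : ℝ) ≤ B := by positivity
    have : (B : ℝ) * logHeight₁ ((ua : ℚ) / ub) ≤ B * (Real.log ua + Real.log ub) :=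
      mul_le_mul_of_nonneg_left hhy hB0
    linarith

/-- **Philippon's door (log form).** If for some `0 ≤ ε < 1/2`, `α, β ≥ 0`, `B ≥ 1` every
`x, y ∈ ℚ^×` with `x y^B + 1 ≠ 0` satisfies
`log |num (x y^B + 1)| ≤ B (α h(x) + ε h(y)) + (αB + ε)(log rad (num (x y^B + 1)) + β)`,
then every abc-triple satisfies `log c ≤ ((2αB² + αB + ε)/(1 − 2ε)) · (log rad(abc) + β)`.
(Philippon's constant is `B(αB+ε)/(1−2ε)`; the argument is his.)
[cite: Philippon2000Addendum, Conséquence, p. 167–168] -/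
theorem soloInformed_log_le_of_philippon {ε α β : ℝ} {B : ℕ}
    (hε : 0 ≤ ε) (hε2 : ε < 1 / 2) (hα : 0 ≤ α) (hβ : 0 ≤ β) (hB : 0 < B)
    (hPL : ∀ x y : ℚ, x ≠ 0 → y ≠ 0 → x * y ^ B + 1 ≠ 0 →
      Real.log (((x * y ^ B + 1).num.natAbs : ℕ) : ℝ) ≤
        (B : ℝ) * (α * logHeight₁ x + ε * logHeight₁ y) +
          (α * B + ε) *
            (Real.log ((radical (x * y ^ B + 1).num.natAbs : ℕ) : ℝ) + β))
    {a b c : ℕ} (habc : IsABCTriple a b c) :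
    Real.log (c : ℝ) ≤
      (2 * α * (B : ℝ) ^ 2 + α * B + ε) / (1 - 2 * ε) *
        (Real.log ((rad a b c : ℕ) : ℝ) + β) := by
  obtain ⟨x, y, hx0, hy0, hne, hnumabs, hxB, hyB⟩ := soloInformed_philippon_split habc hB
  obtain ⟨ha, hb, hsum, hcop⟩ := habc
  have hc : 0 < c := by omega
  have habc0 : a * b * c ≠ 0 := Nat.pos_iff_ne_zero.mp (Nat.mul_pos (Nat.mul_pos ha hb) hc)
  have hR0 : 0 < rad a b c := Nat.radical_pos _
  have hradc_le : radical c ≤ rad a b c :=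
    Nat.le_of_dvd hR0 (radical_dvd_radical (Dvd.intro_left (a * b) (by ring)) habc0)
  -- apply the hypothesis
  have hmain := hPL x y hx0 hy0 hne
  rw [hnumabs] at hmain
  -- numeric bookkeeping
  set LR : ℝ := Real.log ((rad a b c : ℕ) : ℝ) with hLR_def
  have hR1 : (1 : ℝ) ≤ ((rad a b c : ℕ) : ℝ) := by exact_mod_cast hR0
  have hLR0 : 0 ≤ LR := Real.log_nonneg hR1
  have hlogc0 : 0 ≤ Real.log (c : ℝ) := Real.log_nonneg (by exact_mod_cast hc)
  have hradc_pos : (0 : ℝ) < (radical c : ℕ) := by exact_mod_cast Nat.radical_pos c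
  have h_radc : Real.log ((radical c : ℕ) : ℝ) ≤ LR :=
    Real.log_le_log hradc_pos (by exact_mod_cast hradc_le)
  have hB0 : (0 : ℝ) < B := by exact_mod_cast hB
  have hαB : 0 ≤ α * B + ε := by positivity
  -- assemble
  have t1 : (B : ℝ) * (α * logHeight₁ x) ≤ B * (α * (2 * B * LR)) :=
    mul_le_mul_of_nonneg_left (mul_le_mul_of_nonneg_left hxB hα) hB0.le
  have t2 : (B : ℝ) * (ε * logHeight₁ y) ≤ ε * (2 * Real.log c) := by
    calc (B : ℝ) * (ε * logHeight₁ y) = ε * (B * logHeight₁ y) := by ring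
      _ ≤ ε * (2 * Real.log c) := mul_le_mul_of_nonneg_left hyB hε
  have t3 : (α * B + ε) * (Real.log ((radical c : ℕ) : ℝ) + β) ≤ (α * B + ε) * (LR + β) :=
    mul_le_mul_of_nonneg_left (by linarith) hαB
  have t4 : Real.log c ≤
      2 * α * (B : ℝ) ^ 2 * LR + 2 * ε * Real.log c + (α * B + ε) * (LR + β) := by
    have e : (B : ℝ) * (α * logHeight₁ x + ε * logHeight₁ y) =
        B * (α * logHeight₁ x) + B * (ε * logHeight₁ y) := by ring
    rw [e] at hmain
    linarith
  have t5 : 0 ≤ α * (B : ℝ) ^ 2 * β := by positivity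
  have h12 : 0 < 1 - 2 * ε := by linarith
  rw [div_mul_eq_mul_div, le_div_iff₀ h12]
  nlinarith [t4, t5]

/-- **Philippon's door: the conjecture implies polynomial abc** (in the shape of
`SoloInformedWall.lean`: `∃ M K, ∀ abc-triples, c ≤ K · rad(abc)^M`).
[cite: Philippon2000Addendum, Conséquence, p. 167–168] -/
theorem soloInformed_polynomialABC_of_philippon {ε α β : ℝ} {B : ℕ}
    (hε : 0 ≤ ε) (hε2 : ε < 1 / 2) (hα : 0 ≤ α) (hβ : 0 ≤ β) (hB : 0 < B)
    (hPL : ∀ x y : ℚ, x ≠ 0 → y ≠ 0 → x * y ^ B + 1 ≠ 0 →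
      Real.log (((x * y ^ B + 1).num.natAbs : ℕ) : ℝ) ≤
        (B : ℝ) * (α * logHeight₁ x + ε * logHeight₁ y) +
          (α * B + ε) *
            (Real.log ((radical (x * y ^ B + 1).num.natAbs : ℕ) : ℝ) + β)) :
    ∃ M : ℕ, ∃ K : ℝ, 0 < K ∧
      ∀ a b c : ℕ, IsABCTriple a b c → (c : ℝ) ≤ K * ((rad a b c : ℕ) : ℝ) ^ M := by
  set lam : ℝ := (2 * α * (B : ℝ) ^ 2 + α * B + ε) / (1 - 2 * ε) with hlam_def
  have h12 : 0 < 1 - 2 * ε := by linarith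
  have hlam : 0 ≤ lam := div_nonneg (by positivity) h12.le
  refine ⟨⌈lam⌉₊, Real.exp (lam * β), Real.exp_pos _, fun a b c habc => ?_⟩
  have h := soloInformed_log_le_of_philippon hε hε2 hα hβ hB hPL habc
  have hc0 : (0 : ℝ) < c := by
    obtain ⟨ha, hb, hsum, _⟩ := habc
    exact_mod_cast (show 0 < c by omega)
  have hR0 : (0 : ℝ) < ((rad a b c : ℕ) : ℝ) := by exact_mod_cast Nat.radical_pos _
  have hR1 : (1 : ℝ) ≤ ((rad a b c : ℕ) : ℝ) := by exact_mod_cast Nat.radical_pos _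
  calc (c : ℝ) = Real.exp (Real.log c) := (Real.exp_log hc0).symm
    _ ≤ Real.exp (lam * (Real.log ((rad a b c : ℕ) : ℝ) + β)) := Real.exp_le_exp.mpr h
    _ = Real.exp (lam * β) * ((rad a b c : ℕ) : ℝ) ^ lam := by
        rw [mul_add, add_comm, Real.exp_add, Real.rpow_def_of_pos hR0, mul_comm (Real.log _)]
    _ ≤ Real.exp (lam * β) * ((rad a b c : ℕ) : ℝ) ^ (⌈lam⌉₊ : ℝ) :=
        mul_le_mul_of_nonneg_left (Real.rpow_le_rpow_of_exponent_le hR1 (Nat.le_ceil lam))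
          (Real.exp_pos _).le
    _ = Real.exp (lam * β) * ((rad a b c : ℕ) : ℝ) ^ ⌈lam⌉₊ := by rw [Real.rpow_natCast]

/-! ### Remarque (1): for `ε = 1` the hypothesis is Liouville's inequality -/

/-- **The `ε = 1` case is trivial (Liouville).** For `α ≥ 1`, `β ≥ log 2`, `B ≥ 1` and all
`x, y ∈ ℚ^×` with `x y^B + 1 ≠ 0`:
`log |num (x y^B + 1)| ≤ B (α h(x) + 1 · h(y)) + (αB + 1)(log rad (num (x y^B + 1)) + β)`,
because `log |num z| ≤ h(z) ≤ h(x) + B h(y) + log 2` for `z = x y^B + 1`.  So the content of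
Philippon's conjecture is precisely the factor `ε < 1/2`. [cite: Philippon2000Addendum, Remarque (1), p. 168] -/
theorem soloInformed_philippon_of_liouville {α β : ℝ} {B : ℕ}
    (hα : 1 ≤ α) (hβ : Real.log 2 ≤ β) (hB : 0 < B)
    (x y : ℚ) (hne : x * y ^ B + 1 ≠ 0) :
    Real.log (((x * y ^ B + 1).num.natAbs : ℕ) : ℝ) ≤
      (B : ℝ) * (α * logHeight₁ x + 1 * logHeight₁ y) +
        (α * B + 1) *
          (Real.log ((radical (x * y ^ B + 1).num.natAbs : ℕ) : ℝ) + β) := by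
  set z : ℚ := x * y ^ B + 1 with hz_def
  -- log |num z| ≤ h(z)
  have hnum0 : z.num ≠ 0 := Rat.num_ne_zero.mpr hne
  have hnumpos : 0 < z.num.natAbs := Int.natAbs_pos.mpr hnum0
  have h1 : Real.log ((z.num.natAbs : ℕ) : ℝ) ≤ logHeight₁ z := by
    rw [Rat.logHeight₁_eq_log_max]
    exact Real.log_le_log (by exact_mod_cast hnumpos) (by exact_mod_cast le_max_left _ _)
  -- h(z) ≤ log 2 + h(x y^B) ≤ log 2 + h(x) + B h(y)
  have h2 : logHeight₁ z ≤ Real.log 2 + logHeight₁ x + B * logHeight₁ y := by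
    have hadd := logHeight₁_add_le (x * y ^ B) (1 : ℚ)
    rw [NumberField.totalWeight_eq_finrank, Module.finrank_self, logHeight₁_one] at hadd
    have hmul := logHeight₁_mul_le x (y ^ B)
    rw [logHeight₁_pow] at hmul
    simp only [Nat.cast_one, one_mul, add_zero] at hadd
    linarith
  -- nonnegativity of the extra terms
  have hx0 : 0 ≤ logHeight₁ x := zero_le_logHeight₁ x
  have hy0 : 0 ≤ logHeight₁ y := zero_le_logHeight₁ y
  have hrad0 : 0 ≤ Real.log ((radical z.num.natAbs : ℕ) : ℝ) :=
    Real.log_nonneg (by exact_mod_cast Nat.radical_pos _)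
  have hB1 : (1 : ℝ) ≤ B := by exact_mod_cast hB
  have hBα : (1 : ℝ) ≤ B * α := by nlinarith
  have hlog2 : 0 ≤ Real.log 2 := Real.log_nonneg (by norm_num)
  have t1 : logHeight₁ x ≤ (B : ℝ) * (α * logHeight₁ x) := by nlinarith
  have t2 : Real.log 2 ≤ (α * B + 1) * β := by nlinarith
  have t3 : 0 ≤ (α * B + 1) * Real.log ((radical z.num.natAbs : ℕ) : ℝ) := by positivity
  nlinarith [h1, h2, t1, t2, t3, hy0]

end Summit.ABC.ABC.Theorems
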